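import Mathlib
import Literature.Computability.AlgebraicComplexity.LinSubst
import Summits.ValiantsHypothesis.ValiantsHypothesis.Theorems.BorderApolarityFixedWitnessObstructionQPH0Elementary
import Summits.ValiantsHypothesis.ValiantsHypothesis.Theorems.BorderApolarityToricWitnessObstructionQPStubStabTorus

/-!
# Border apolarity, crux `ToricWitnessObstructionQP` (stmt-ValiantsHypothesis-14753) — line `Sketch`,
# reshape 4: helper `rawW4_of_cleanStabilities` (reassembling the transported W4)

Route `ValiantsHypothesis/BorderApolarity`, crux item `stmt-ValiantsHypothesis-14753`, line `Sketch`,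
reshape 4, wave-2 helper `rawW4_of_cleanStabilities` (the converse direction of the unpacking of the
raw stability clause W4).

Notation: `σ := Fin m × Fin m`, the "own" variables are `ess a := (m-n ≤ a.1 ∧ m-n ≤ a.2) ∨ a = (0,0)`,
the others are "unused"; `rk a := (if ess a then 0 else m*m) + (a.1*m + a.2)`.  The group `H₀(n,m)`
consists of the invertible `M` with (a) `M j i ≠ 0 → rk j ≤ rk i`, (b) own columns diagonal,
(c) rank-one pattern of the own block-diagonal entries, (d) character
`M₀₀^{m-n} ∏_{block i} M_{(ii)(ii)} = 1`.  The residual of the line records three CLEAN stabilities of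
the family `J'`: (ST) under `linSubst (diagonal t)` for clean pattern-torus elements `t`, (SH) under
`linSubst (1 + C)` for `C` supported on unused rows × own columns, (SB) under `linSubst ((q⁻¹ L q)ᵀ)`
for invertible `L` with coordinate own columns and `rk`-triangular unused block; `q` fixes the own
variables.  This file reassembles from them the transported W4: for every `A ∈ H₀(n,m)` and `k ≤ m`,
`J' k` is stable under `linSubst ((q⁻¹ A q)ᵀ)`.

Proof: factor `A = A₁ · diagonal t` with `t a := A a a` on own `a` and `t = 1` elsewhere; `A₁` has
coordinate own columns and the unused block of `A`, so (SB) handles `(q⁻¹ A₁ q)ᵀ`; for the torus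
factor, `q⁻¹ · diagonal t · q = diagonal t · (1 + E)` with `E` supported on own rows × unused columns
(`stabTorus_corr_support`), so `(q⁻¹ · diagonal t · q)ᵀ = (1 + Eᵀ) · diagonal t` is handled by (ST)
followed by (SH).
-/

open MvPolynomial Filter
open scoped BigOperators Matrix
open Literature.Computability.AlgebraicComplexity

-- the mandated summit-side namespace repeats a component by design (single-problem summit)
set_option linter.dupNamespace false

namespace Summit.ValiantsHypothesis.ValiantsHypothesis.Theorems.BorderApolarityToricWitnessObstructionQP

/-- **Conjugated clean torus elements act through (ST) and (SH).**  With `Pi * P = 1`, coordinate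
`ess`-columns of `P`, Hom-stability of `J'` (stability under `linSubst (1 + C)` for every `C`
supported on `¬ess`-rows × `ess`-columns) and a clean `t` (`t ≠ 0`, `t = 1` off `ess`):
if `linSubst (diagonal t) D ∈ J' k` then `linSubst ((Pi * diagonal t * P)ᵀ) D ∈ J' k`, because
`Pi * diagonal t * P = diagonal t * (1 + E)` with `E` supported on `ess × ¬ess`, so
`(Pi * diagonal t * P)ᵀ = (1 + Eᵀ) * diagonal t`. [folklore] -/
theorem rawW4cs_outer {σ : Type*} [Fintype σ] [DecidableEq σ] (ess : σ → Prop)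
    (J' : ℕ → Set (MvPolynomial σ ℂ)) (m : ℕ) (P Pi : Matrix σ σ ℂ) (hPiP : Pi * P = 1)
    (hPcol : ∀ a, ess a → ∀ b, P b a = if b = a then 1 else 0)
    (hSH : ∀ C : Matrix σ σ ℂ, (∀ j i, C j i ≠ 0 → ¬ ess j ∧ ess i) →
      ∀ k ≤ m, ∀ D ∈ J' k, linSubst σ ℂ (1 + C) D ∈ J' k)
    (t : σ → ℂ) (ht0 : ∀ i, t i ≠ 0) (ht1 : ∀ z, ¬ ess z → t z = 1)
    (k : ℕ) (hk : k ≤ m) (D : MvPolynomial σ ℂ)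
    (hmem : linSubst σ ℂ (Matrix.diagonal t) D ∈ J' k) :
    linSubst σ ℂ (Pi * Matrix.diagonal t * P)ᵀ D ∈ J' k := by
  -- the correction matrix `E` and its support
  obtain ⟨E, hEdef⟩ : ∃ E : Matrix σ σ ℂ,
      E = Matrix.diagonal (fun i => (t i)⁻¹) * (Pi * Matrix.diagonal t * P) - 1 := ⟨_, rfl⟩
  have hE : ∀ b a, E b a ≠ 0 → ess b ∧ ¬ ess a := by
    rw [hEdef]
    exact stabTorus_corr_support ess P Pi hPiP hPcol t ht0 ht1
  -- the key matrix identity `Pi * Dt * P = Dt * (1 + E)`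
  have hDD : Matrix.diagonal t * Matrix.diagonal (fun i => (t i)⁻¹) = 1 := by
    rw [Matrix.diagonal_mul_diagonal, ← Matrix.diagonal_one]
    congr 1
    funext i
    exact mul_inv_cancel₀ (ht0 i)
  have hkey : Pi * Matrix.diagonal t * P = Matrix.diagonal t * (1 + E) := by
    rw [hEdef, add_sub_cancel, ← Matrix.mul_assoc, hDD, Matrix.one_mul]
  have htr : (Pi * Matrix.diagonal t * P)ᵀ = (1 + Eᵀ) * Matrix.diagonal t := by
    rw [hkey, Matrix.transpose_mul, Matrix.transpose_add, Matrix.transpose_one,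
      Matrix.diagonal_transpose]
  rw [htr, linSubst_mul, AlgHom.comp_apply]
  -- the factor `1 + Eᵀ` is a Hom-substitution
  have hC : ∀ j i, Eᵀ j i ≠ 0 → ¬ ess j ∧ ess i := fun j i h => by
    rw [Matrix.transpose_apply] at h
    exact ⟨(hE i j h).2, (hE i j h).1⟩
  exact hSH Eᵀ hC k hk _ hmem

/-- **H2 (wave 2 helper): the clean stabilities (ST), (SH), (SB) of `J'` reassemble the transported
stability clause W4**: `J'` is stable under `(q⁻¹ M q)ᵀ` for every `M ∈ H₀(n,m)`.  Factor
`M = M₁ · diagonal t` (`t = ` own diagonal entries of `M`, `1` elsewhere): `M₁` has coordinate own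
columns and the unused block of `M`, so `(q⁻¹ M₁ q)ᵀ` acts by (SB), and `(q⁻¹ · diagonal t · q)ᵀ =
(1 + Eᵀ) · diagonal t` acts by (ST) then (SH). [folklore] -/
theorem rawW4_of_cleanStabilities : ∀ (n m : ℕ) [NeZero m] (q : GL (Fin m × Fin m) ℂ)
    (J' : ℕ → Set (MvPolynomial (Fin m × Fin m) ℂ)),
    (∀ a : Fin m × Fin m, ((m - n ≤ (a.1 : ℕ) ∧ m - n ≤ (a.2 : ℕ)) ∨ a = (0, 0)) →
      ∀ b : Fin m × Fin m, (q : Matrix (Fin m × Fin m) (Fin m × Fin m) ℂ) b a = if b = a then 1 else 0) →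
    (∀ t : Fin m × Fin m → ℂ, (∀ i, t i ≠ 0) →
      (∀ z : Fin m × Fin m, ¬ (((m - n ≤ (z.1 : ℕ) ∧ m - n ≤ (z.2 : ℕ)) ∨ z = (0, 0))) → t z = 1) →
      (∀ i k j l : Fin m, m - n ≤ (i : ℕ) → m - n ≤ (k : ℕ) → m - n ≤ (j : ℕ) → m - n ≤ (l : ℕ) →
        t (i, j) * t (k, l) = t (i, l) * t (k, j)) →
      t (0, 0) ^ (m - n) * ∏ i ∈ Finset.univ.filter (fun i : Fin m => m - n ≤ (i : ℕ)), t (i, i) = 1 →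
      ∀ k ≤ m, ∀ D ∈ J' k, linSubst (Fin m × Fin m) ℂ (Matrix.diagonal t) D ∈ J' k) →
    (∀ C : Matrix (Fin m × Fin m) (Fin m × Fin m) ℂ,
      (∀ j i : Fin m × Fin m, C j i ≠ 0 →
        ¬ (((m - n ≤ (j.1 : ℕ) ∧ m - n ≤ (j.2 : ℕ)) ∨ j = (0, 0))) ∧
          (((m - n ≤ (i.1 : ℕ) ∧ m - n ≤ (i.2 : ℕ)) ∨ i = (0, 0)))) →
      ∀ k ≤ m, ∀ D ∈ J' k, linSubst (Fin m × Fin m) ℂ (1 + C) D ∈ J' k) →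
    (∀ L : Matrix.GeneralLinearGroup (Fin m × Fin m) ℂ,
      let M : Matrix (Fin m × Fin m) (Fin m × Fin m) ℂ := L
      let rk := fun (a : Fin m × Fin m) =>
        (if (m - n ≤ (a.1 : ℕ) ∧ m - n ≤ (a.2 : ℕ)) ∨ a = (0, 0) then 0 else m * m) + ((a.1 : ℕ) * m + (a.2 : ℕ))
      (∀ a : Fin m × Fin m, ((m - n ≤ (a.1 : ℕ) ∧ m - n ≤ (a.2 : ℕ)) ∨ a = (0, 0)) →
        ∀ b : Fin m × Fin m, M b a = if b = a then 1 else 0) →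
      (∀ i j : Fin m × Fin m, ¬ (((m - n ≤ (i.1 : ℕ) ∧ m - n ≤ (i.2 : ℕ)) ∨ i = (0, 0))) →
        ¬ (((m - n ≤ (j.1 : ℕ) ∧ m - n ≤ (j.2 : ℕ)) ∨ j = (0, 0))) → M j i ≠ 0 → rk j ≤ rk i) →
      ∀ k ≤ m, ∀ D ∈ J' k,
        linSubst (Fin m × Fin m) ℂ (((q⁻¹ : GL (Fin m × Fin m) ℂ) : Matrix (Fin m × Fin m) (Fin m × Fin m) ℂ) *
          M * (q : Matrix (Fin m × Fin m) (Fin m × Fin m) ℂ))ᵀ D ∈ J' k) →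
    ∀ A : Matrix.GeneralLinearGroup (Fin m × Fin m) ℂ,
      let M : Matrix (Fin m × Fin m) (Fin m × Fin m) ℂ := A
      let rk := fun (a : Fin m × Fin m) =>
        (if (m - n ≤ (a.1 : ℕ) ∧ m - n ≤ (a.2 : ℕ)) ∨ a = (0, 0) then 0 else m * m) + ((a.1 : ℕ) * m + (a.2 : ℕ))
      (∀ i j : Fin m × Fin m, M j i ≠ 0 → rk j ≤ rk i) →
      (∀ i j : Fin m × Fin m, ((m - n ≤ (i.1 : ℕ) ∧ m - n ≤ (i.2 : ℕ)) ∨ i = (0, 0)) → j ≠ i → M j i = 0) →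
      (∀ i k j l : Fin m, m - n ≤ (i : ℕ) → m - n ≤ (k : ℕ) → m - n ≤ (j : ℕ) → m - n ≤ (l : ℕ) →
        M (i, j) (i, j) * M (k, l) (k, l) = M (i, l) (i, l) * M (k, j) (k, j)) →
      M (0, 0) (0, 0) ^ (m - n) * ∏ i ∈ Finset.univ.filter (fun i : Fin m => m - n ≤ (i : ℕ)), M (i, i) (i, i) = 1 →
      ∀ k ≤ m, ∀ D ∈ J' k,
        linSubst (Fin m × Fin m) ℂ (((q⁻¹ : GL (Fin m × Fin m) ℂ) : Matrix (Fin m × Fin m) (Fin m × Fin m) ℂ) *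
          M * (q : Matrix (Fin m × Fin m) (Fin m × Fin m) ℂ))ᵀ D ∈ J' k := by
  intro n m _ q J' hq hST hSH hSB A
  dsimp only
  intro ha hb hc hd k hk D hD
  -- the torus part `t` of `A`: own diagonal entries, `1` elsewhere
  obtain ⟨t, htdef⟩ : ∃ t : Fin m × Fin m → ℂ, t = fun a =>
      if (m - n ≤ (a.1 : ℕ) ∧ m - n ≤ (a.2 : ℕ)) ∨ a = (0, 0)
        then (A : Matrix (Fin m × Fin m) (Fin m × Fin m) ℂ) a a else 1 := ⟨_, rfl⟩
  -- own diagonal entries of `A` are nonzero (otherwise an own column of `A` vanishes)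
  have hdiag : ∀ a : Fin m × Fin m, ((m - n ≤ (a.1 : ℕ) ∧ m - n ≤ (a.2 : ℕ)) ∨ a = (0, 0)) →
      (A : Matrix (Fin m × Fin m) (Fin m × Fin m) ℂ) a a ≠ 0 := by
    intro a ha0 h0
    apply (Matrix.isUnits_det_units A).ne_zero
    refine Matrix.det_eq_zero_of_column_eq_zero a fun b => ?_
    by_cases hba : b = a
    · rw [hba]
      exact h0
    · exact hb a b ha0 hba
  have htess : ∀ z : Fin m × Fin m, (((m - n ≤ (z.1 : ℕ) ∧ m - n ≤ (z.2 : ℕ)) ∨ z = (0, 0))) →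
      t z = (A : Matrix (Fin m × Fin m) (Fin m × Fin m) ℂ) z z := fun z hz => by
    rw [htdef]
    exact if_pos hz
  have ht1 : ∀ z : Fin m × Fin m, ¬ (((m - n ≤ (z.1 : ℕ) ∧ m - n ≤ (z.2 : ℕ)) ∨ z = (0, 0))) →
      t z = 1 := fun z hz => by
    rw [htdef]
    exact if_neg hz
  have ht0 : ∀ i, t i ≠ 0 := by
    intro i
    by_cases hi : (m - n ≤ (i.1 : ℕ) ∧ m - n ≤ (i.2 : ℕ)) ∨ i = (0, 0)
    · rw [htess i hi]
      exact hdiag i hi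
    · rw [ht1 i hi]
      exact one_ne_zero
  have htc : ∀ i k j l : Fin m, m - n ≤ (i : ℕ) → m - n ≤ (k : ℕ) → m - n ≤ (j : ℕ) →
      m - n ≤ (l : ℕ) → t (i, j) * t (k, l) = t (i, l) * t (k, j) := by
    intro i k' j l hi hk' hj hl
    rw [htess (i, j) (Or.inl ⟨hi, hj⟩), htess (k', l) (Or.inl ⟨hk', hl⟩),
      htess (i, l) (Or.inl ⟨hi, hl⟩), htess (k', j) (Or.inl ⟨hk', hj⟩)]
    exact hc i k' j l hi hk' hj hl
  have htd : t (0, 0) ^ (m - n) *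
      ∏ i ∈ Finset.univ.filter (fun i : Fin m => m - n ≤ (i : ℕ)), t (i, i) = 1 := by
    have hprod : ∏ i ∈ Finset.univ.filter (fun i : Fin m => m - n ≤ (i : ℕ)), t (i, i) =
        ∏ i ∈ Finset.univ.filter (fun i : Fin m => m - n ≤ (i : ℕ)),
          (A : Matrix (Fin m × Fin m) (Fin m × Fin m) ℂ) (i, i) (i, i) := by
      refine Finset.prod_congr rfl fun i hi => ?_
      have hi' : m - n ≤ (i : ℕ) := (Finset.mem_filter.mp hi).2
      exact htess (i, i) (Or.inl ⟨hi', hi'⟩)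
    rw [htess (0, 0) (Or.inr rfl), hprod]
    exact hd
  -- the Borel-like part `M₁ := A * diagonal t⁻¹`
  obtain ⟨M₁, hM₁def⟩ : ∃ M₁ : Matrix (Fin m × Fin m) (Fin m × Fin m) ℂ,
      M₁ = (A : Matrix (Fin m × Fin m) (Fin m × Fin m) ℂ) * Matrix.diagonal (fun a => (t a)⁻¹) :=
    ⟨_, rfl⟩
  have hM₁apply : ∀ b a, M₁ b a = (A : Matrix (Fin m × Fin m) (Fin m × Fin m) ℂ) b a * (t a)⁻¹ := by
    intro b a
    rw [hM₁def, Matrix.mul_diagonal]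
  have hDD : Matrix.diagonal (fun a => (t a)⁻¹) * Matrix.diagonal t = 1 := by
    rw [Matrix.diagonal_mul_diagonal, ← Matrix.diagonal_one]
    congr 1
    funext i
    exact inv_mul_cancel₀ (ht0 i)
  have hfacM : (A : Matrix (Fin m × Fin m) (Fin m × Fin m) ℂ) = M₁ * Matrix.diagonal t := by
    rw [hM₁def, Matrix.mul_assoc, hDD, Matrix.mul_one]
  have hdet1 : M₁.det ≠ 0 := by
    intro h0
    apply (Matrix.isUnits_det_units A).ne_zero
    rw [hfacM, Matrix.det_mul, h0, zero_mul]
  -- own columns of `M₁` are coordinate vectors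
  have hcol1 : ∀ a : Fin m × Fin m, ((m - n ≤ (a.1 : ℕ) ∧ m - n ≤ (a.2 : ℕ)) ∨ a = (0, 0)) →
      ∀ b : Fin m × Fin m, M₁ b a = if b = a then 1 else 0 := by
    intro a ha0 b
    rw [hM₁apply]
    by_cases hba : b = a
    · rw [if_pos hba, hba, htess a ha0]
      exact mul_inv_cancel₀ (hdiag a ha0)
    · rw [if_neg hba, hb a b ha0 hba, zero_mul]
  -- the unused columns of `M₁` are those of `A`
  have hblk1 : ∀ i j : Fin m × Fin m, ¬ (((m - n ≤ (i.1 : ℕ) ∧ m - n ≤ (i.2 : ℕ)) ∨ i = (0, 0))) →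
      M₁ j i = (A : Matrix (Fin m × Fin m) (Fin m × Fin m) ℂ) j i := by
    intro i j hi
    rw [hM₁apply, ht1 i hi, inv_one, mul_one]
  -- (SB) for `M₁`
  have h := hSB (Matrix.GeneralLinearGroup.mkOfDetNeZero M₁ hdet1)
  simp only [Matrix.GeneralLinearGroup.val_mkOfDetNeZero] at h
  have hinner : linSubst (Fin m × Fin m) ℂ
      (((q⁻¹ : GL (Fin m × Fin m) ℂ) : Matrix (Fin m × Fin m) (Fin m × Fin m) ℂ) * M₁ *
        (q : Matrix (Fin m × Fin m) (Fin m × Fin m) ℂ))ᵀ D ∈ J' k := by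
    refine h hcol1 ?_ k hk D hD
    intro i j hi _ hji
    rw [hblk1 i j hi] at hji
    exact ha i j hji
  -- factor the conjugate: `q⁻¹ A q = (q⁻¹ M₁ q) * (q⁻¹ (diagonal t) q)`
  have hfac : ((q⁻¹ : GL (Fin m × Fin m) ℂ) : Matrix (Fin m × Fin m) (Fin m × Fin m) ℂ) *
      (A : Matrix (Fin m × Fin m) (Fin m × Fin m) ℂ) * (q : Matrix (Fin m × Fin m) (Fin m × Fin m) ℂ) =
      (((q⁻¹ : GL (Fin m × Fin m) ℂ) : Matrix (Fin m × Fin m) (Fin m × Fin m) ℂ) * M₁ *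
        (q : Matrix (Fin m × Fin m) (Fin m × Fin m) ℂ)) *
      (((q⁻¹ : GL (Fin m × Fin m) ℂ) : Matrix (Fin m × Fin m) (Fin m × Fin m) ℂ) * Matrix.diagonal t *
        (q : Matrix (Fin m × Fin m) (Fin m × Fin m) ℂ)) := by
    rw [hfacM]
    simp only [Matrix.mul_assoc]
    rw [← Matrix.mul_assoc (q : Matrix (Fin m × Fin m) (Fin m × Fin m) ℂ)
      ((q⁻¹ : GL (Fin m × Fin m) ℂ) : Matrix (Fin m × Fin m) (Fin m × Fin m) ℂ), q.mul_inv,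
      Matrix.one_mul]
  rw [hfac, Matrix.transpose_mul, linSubst_mul, AlgHom.comp_apply]
  exact rawW4cs_outer (fun a : Fin m × Fin m => (m - n ≤ (a.1 : ℕ) ∧ m - n ≤ (a.2 : ℕ)) ∨ a = (0, 0))
    J' m _ _ q.inv_mul hq hSH t ht0 ht1 k hk _ (hST t ht0 ht1 htc htd k hk _ hinner)

end Summit.ValiantsHypothesis.ValiantsHypothesis.Theorems.BorderApolarityToricWitnessObstructionQP
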